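import Mathlib
import Summits.Ventures.FusionMHD.Models.FluxSurfacePolarRayLoop
import Summits.Ventures.FusionMHD.Models.FluxSurfacePolarRayLevelKernels
import HarnessLib

/-!
# Polar-ray chart, LEVEL direction (III): the whole LOOP — `V′(u)` and `q(u)` of the TREE functionals on the glued loop as
# polar integrals for EVERY admissible level, and `dV′/du`, `dq/du` at `u₀` from panels covering `[0, 2π]`

LADDER-GRIDFUSION (F2 item R2 / F1 on the Cerfon–Freidberg rung), cell `gridfusion`, seat `gridfusion-model-7` (g5), 2026-08-27.
Third file of «F2.R2-POLAR-LEVEL-DERIV» (after `Models/FluxSurfacePolarRayLevel.lean`, `…LevelKernels.lean`).  Those files work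
on ONE panel `[a, b] × [s₁, s₂]`; this file assembles a loop: a partition `0 = t₀ ≤ t₁ ≤ … ≤ t_N = 2π` with one
`LevelPanel ψ R_c Z_c (t_j) (t_{j+1}) (σ₁ j) (σ₂ j) u_in u_out D` per panel (`LevelLoop`), plus — for the identification with
the tree's functionals — the Fréchet derivative `L θ s` of `ψ` at the ray points and `R = R_c + s cos θ > 0` on the boxes.

WHAT IS PROVED ([folklore] calculus; the functionals carry their printed source):
* §1 `loopIntegralE_eq_polar_rayRadius` — ★ #88's identity for the GLUED radius and ANY weight `g`:
  `∮ g dℓ/(R²B_p) = ∫₀^{2π} g(γ θ)·ρ(θ)/(R(θ)|D_r(θ)|) dθ` over `γ = loop R_c Z_c ρ_u` (hypotheses as in the Loop file's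
  `safetyFactorE_eq_polar_rayRadius`); `volumeDerivE_eq_polar_rayRadius` — Jardin's `V′ = 2π∮R dℓ/|∇ψ|` (5.29) = Freidberg's
  `dV/dψ = 2π∮ dℓ/B_p` (6.22) on that loop equals `2π∫₀^{2π} R(θ)ρ(θ)/|D_r(θ)| dθ`.
* §2 `LevelLoop` and its consequences for every `u ∈ (u_in, u_out)`: a panel index for every `θ ∈ [0, 2π]` (`exists_panel`),
  the level identity, `ρ_u > 0`, the slope fact `HasDerivAt (ψ∘ray_θ) (D θ (ρ_u θ)) (ρ_u θ)`, `D > 0` there, and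
  `ContinuousOn ρ_u [0, 2π]` (closed-union gluing along the partition).
* §3 **`LevelLoop.volumeDerivE_eq`** / **`LevelLoop.safetyFactorE_eq`**: for every admissible `u`,
  `volumeDerivE ψ (loop R_c Z_c ρ_u) (2π) = 2π ∫₀^{2π} volKernel R_c D θ (ρ_u θ) dθ` and
  `safetyFactorE F ψ (loop R_c Z_c ρ_u) (2π) = (F/2π) ∫₀^{2π} polarIntegrand ψ R_c Z_c u D θ dθ` (the certificate's `D`
  identified with `D_r` by `radialDeriv_eq_of_hasDerivAt`); and **`LevelLoop.hasDerivAt_volumeDerivE`** /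
  **`LevelLoop.hasDerivAt_safetyFactorE`**: with a jointly continuous second ray derivative `D₁ = ∂_s D` on the boxes,
  `HasDerivAt (u ↦ V′(u)) (2π ∫₀^{2π} volKernelDs/D along ρ_{u₀}) u₀` and
  `HasDerivAt (u ↦ q(u)) ((F/2π) ∫₀^{2π} polarKernelDs/D along ρ_{u₀}) u₀` — Jardin (8.134)'s `V″` and, with `Φ′ = 2πq`
  (`FluxSurfaceAverage.toroidalFluxDerivJ`), `Φ″ = 2π dq/dΨ` ON AN IMPLICIT SURFACE, as θ-integrals of explicit kernels.
MODELLED: nothing (pure analysis about a `C¹` flux function with star-shaped level sets around `(R_c, Z_c)`).  NOT CLAIMED: any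
value for any equilibrium; the mirror-symmetric half-loop bookkeeping of a particular instance (★ #117 certifies `[0, π]` and
reflects); that an instance's code lists are `∂_sψ`, `∂_s²ψ`.
-/

noncomputable section

open Real Set Filter Topology MeasureTheory intervalIntegral
open Literature.MathematicalPhysics.MHD.GradShafranov

namespace Summit.Ventures.FusionMHD.Models

namespace PolarRay

/-! ## §1 Loop functionals on the glued loop as polar integrals: general weight, and `V′` -/

section loopIdentities

variable {ψ : ℝ → ℝ → ℝ} {Rc Zc u : ℝ}

/-- **★ #88's IDENTITY FOR THE GLUED RADIUS, ANY WEIGHT `g`.**  Under the hypotheses of the Loop file's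
`safetyFactorE_eq_polar_rayRadius` (level identity and continuity of `ρ = rayRadius ψ R_c Z_c u` on one period, `ρ > 0`, `ψ`
Fréchet-differentiable at the loop points with `D_r ≠ 0`, `R > 0`):
`∮ g dℓ/(R²B_p) = ∫₀^{2π} g(γ θ)·ρ(θ)/(R(θ)·|D_r(θ)|) dθ`. [cite: Freidberg2014, §6.3.2 eq. (6.22)] -/
theorem loopIntegralE_eq_polar_rayRadius (g : ℝ → ℝ → ℝ) {L : ℝ → (ℝ × ℝ →L[ℝ] ℝ)}
    (hlev : ∀ θ ∈ Icc 0 (2 * π), rayProfile ψ Rc Zc θ (rayRadius ψ Rc Zc u θ) = u)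
    (hcont : ContinuousOn (rayRadius ψ Rc Zc u) (Icc 0 (2 * π)))
    (hρ0 : ∀ θ ∈ uIcc 0 (2 * π), 0 < rayRadius ψ Rc Zc u θ)
    (hψ : ∀ θ ∈ uIcc 0 (2 * π), HasFDerivAt (fun p : ℝ × ℝ => ψ p.1 p.2) (L θ) (loop Rc Zc (rayRadius ψ Rc Zc u) θ))
    (hDr : ∀ θ ∈ uIcc 0 (2 * π), radialDeriv (L θ (1, 0)) (L θ (0, 1)) θ ≠ 0)
    (hR : ∀ θ ∈ uIcc 0 (2 * π), 0 < (loop Rc Zc (rayRadius ψ Rc Zc u) θ).1) :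
    loopIntegralE (loop Rc Zc (rayRadius ψ Rc Zc u)) (2 * π) (fun R Z => g R Z / (R ^ 2 * fieldBpol ψ R Z))
      = ∫ θ in (0 : ℝ)..(2 * π), g (loop Rc Zc (rayRadius ψ Rc Zc u) θ).1 (loop Rc Zc (rayRadius ψ Rc Zc u) θ).2
          * (rayRadius ψ Rc Zc u θ
              / ((loop Rc Zc (rayRadius ψ Rc Zc u) θ).1 * |radialDeriv (L θ (1, 0)) (L θ (0, 1)) θ|)) := by
  set ρ := rayRadius ψ Rc Zc u with hρdef
  have hper : Function.Periodic ρ (2 * π) := periodic_rayRadius ψ Rc Zc u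
  have hG : Function.Periodic (fun θ => rayProfile ψ Rc Zc θ (ρ θ)) (2 * π) := by
    intro θ; simp only [hper θ, periodic_rayProfile ψ Rc Zc _ θ]
  have hlev' : ∀ θ, rayProfile ψ Rc Zc θ (ρ θ) = u := eq_of_periodic_of_eqOn_Icc hG two_pi_pos hlev
  have hρc : Continuous ρ := continuous_of_periodic_of_continuousOn_Icc hper two_pi_pos hcont
  have hderiv : ∀ θ ∈ uIcc 0 (2 * π), HasDerivAt ρ
      (-(ρ θ * tangentialDeriv (L θ (1, 0)) (L θ (0, 1)) θ) / radialDeriv (L θ (1, 0)) (L θ (0, 1)) θ) θ := by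
    intro θ hθ
    have hψ' : HasFDerivAt (fun p : ℝ × ℝ => ψ p.1 p.2) (L θ) (rayPoint Rc Zc θ (ρ θ)) := by
      rw [← loop_eq_rayPoint]; exact hψ θ hθ
    have hL := hasFDerivAt_rayProfile hψ'
    have hlevel_ev : ∀ᶠ t in 𝓝 θ, (fun p : ℝ × ℝ => rayProfile ψ Rc Zc p.1 p.2) (t, ρ t)
        = (fun p : ℝ × ℝ => rayProfile ψ Rc Zc p.1 p.2) (θ, ρ θ) :=
      Eventually.of_forall fun t => by simp only [hlev']
    have h := hasDerivAt_of_implicit (F := fun p : ℝ × ℝ => rayProfile ψ Rc Zc p.1 p.2) (g := ρ) (x₀ := θ)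
      hρc.continuousAt hlevel_ev hL (by rw [rayProfile_partial_s]; exact hDr θ hθ)
    rw [rayProfile_partial_theta, rayProfile_partial_s] at h
    exact h
  have hlevel : ∀ θ ∈ uIcc 0 (2 * π), HasDerivAt (fun t => ψ (loop Rc Zc ρ t).1 (loop Rc Zc ρ t).2) 0 θ := by
    intro θ _
    have e : (fun t => ψ (loop Rc Zc ρ t).1 (loop Rc Zc ρ t).2) = fun _ => u := funext fun t => hlev' t
    rw [e]; exact hasDerivAt_const θ u
  exact loopIntegralE_eq_polar g (fun θ hθ => hderiv θ hθ) hρ0 hψ hlevel hDr hR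

/-- **`V′` ON THE GLUED LOOP AS A POLAR INTEGRAL**: under the same hypotheses,
`volumeDerivE ψ γ (2π) = 2π ∮ dℓ/B_p = 2π ∫₀^{2π} R(θ)·ρ(θ)/|D_r(θ)| dθ` (Jardin (5.29) `V′ = 2π∮R dℓ/|∇ψ|` = Freidberg (6.22),
with `dℓ/|∇ψ| = ρ dθ/|D_r|`). [cite: Jardin2010, §5.3 eq. (5.29)] -/
theorem volumeDerivE_eq_polar_rayRadius {L : ℝ → (ℝ × ℝ →L[ℝ] ℝ)}
    (hlev : ∀ θ ∈ Icc 0 (2 * π), rayProfile ψ Rc Zc θ (rayRadius ψ Rc Zc u θ) = u)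
    (hcont : ContinuousOn (rayRadius ψ Rc Zc u) (Icc 0 (2 * π)))
    (hρ0 : ∀ θ ∈ uIcc 0 (2 * π), 0 < rayRadius ψ Rc Zc u θ)
    (hψ : ∀ θ ∈ uIcc 0 (2 * π), HasFDerivAt (fun p : ℝ × ℝ => ψ p.1 p.2) (L θ) (loop Rc Zc (rayRadius ψ Rc Zc u) θ))
    (hDr : ∀ θ ∈ uIcc 0 (2 * π), radialDeriv (L θ (1, 0)) (L θ (0, 1)) θ ≠ 0)
    (hR : ∀ θ ∈ uIcc 0 (2 * π), 0 < (loop Rc Zc (rayRadius ψ Rc Zc u) θ).1) :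
    volumeDerivE ψ (loop Rc Zc (rayRadius ψ Rc Zc u)) (2 * π)
      = 2 * π * ∫ θ in (0 : ℝ)..(2 * π), (loop Rc Zc (rayRadius ψ Rc Zc u) θ).1 * rayRadius ψ Rc Zc u θ
          / |radialDeriv (L θ (1, 0)) (L θ (0, 1)) θ| := by
  have h := loopIntegralE_eq_polar_rayRadius (fun R _ => R ^ 2) hlev hcont hρ0 hψ hDr hR
  unfold volumeDerivE
  congr 1
  -- `1/B_p = R²/(R²B_p)` along the loop (R > 0), then simplify the polar integrand
  have e1 : loopIntegralE (loop Rc Zc (rayRadius ψ Rc Zc u)) (2 * π) (fun R Z => 1 / fieldBpol ψ R Z)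
      = loopIntegralE (loop Rc Zc (rayRadius ψ Rc Zc u)) (2 * π) (fun R Z => R ^ 2 / (R ^ 2 * fieldBpol ψ R Z)) := by
    unfold loopIntegralE
    apply intervalIntegral.integral_congr
    intro θ hθ
    have hR0 : (loop Rc Zc (rayRadius ψ Rc Zc u) θ).1 ^ 2 ≠ 0 := pow_ne_zero 2 (hR θ hθ).ne'
    simp only
    rw [← mul_div_mul_left (1 : ℝ) (fieldBpol ψ _ _) hR0, mul_one]
  rw [e1, h]
  apply intervalIntegral.integral_congr
  intro θ hθ
  have hR0 : (loop Rc Zc (rayRadius ψ Rc Zc u) θ).1 ≠ 0 := (hR θ hθ).ne'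
  simp only
  field_simp

end loopIdentities

/-! ## §2 A loop covered by level panels -/

/-- **A LOOP OF LEVEL PANELS**: a partition `t₀ = 0, …, t_N = 2π` of one period and, on each panel `[t_j, t_{j+1}]`, the panel
hypotheses with level margins `LevelPanel ψ R_c Z_c (t j) (t (j+1)) (σ₁ j) (σ₂ j) u_in u_out D` (radial brackets may vary with the
panel; the level margins and the radial-derivative field `D` are common). [folklore] -/
structure LevelLoop (ψ : ℝ → ℝ → ℝ) (Rc Zc uin uout : ℝ) (D : ℝ → ℝ → ℝ) (N : ℕ) (t σ₁ σ₂ : ℕ → ℝ) : Prop where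
  /-- the partition starts at `0` -/
  t_zero : t 0 = 0
  /-- … and ends at `2π` -/
  t_last : t N = 2 * π
  /-- every panel carries the panel hypotheses with level margins -/
  panel : ∀ j < N, LevelPanel ψ Rc Zc (t j) (t (j + 1)) (σ₁ j) (σ₂ j) uin uout D

/-- Covering lemma for a monotone chain: `t₀ ≤ θ ≤ t_n`, `0 < n` ⇒ `θ ∈ [t_j, t_{j+1}]` for some `j < n`. [folklore] -/
theorem exists_Icc_of_chain {t : ℕ → ℝ} :
    ∀ n : ℕ, (∀ j < n, t j ≤ t (j + 1)) → 0 < n → ∀ θ, t 0 ≤ θ → θ ≤ t n → ∃ j < n, θ ∈ Icc (t j) (t (j + 1)) := by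
  intro n
  induction n with
  | zero => intro _ h; exact absurd h (lt_irrefl 0)
  | succ n ih =>
    intro hmono _ θ h0 hn
    by_cases hcase : 0 < n ∧ θ ≤ t n
    · obtain ⟨j, hj, hθ⟩ := ih (fun j hj => hmono j (Nat.lt_succ_of_lt hj)) hcase.1 θ h0 hcase.2
      exact ⟨j, Nat.lt_succ_of_lt hj, hθ⟩
    · rcases Nat.eq_zero_or_pos n with hn0 | hnpos
      · subst hn0
        exact ⟨0, Nat.zero_lt_succ 0, ⟨h0, hn⟩⟩
      · have hlt : t n < θ := by
          by_contra hle; exact hcase ⟨hnpos, not_lt.1 hle⟩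
        exact ⟨n, Nat.lt_succ_self n, ⟨hlt.le, hn⟩⟩

/-- Gluing lemma for a monotone chain: continuity on every panel ⇒ continuity on `[t₀, t_n]`. [folklore] -/
theorem continuousOn_Icc_of_chain {t : ℕ → ℝ} {f : ℝ → ℝ} :
    ∀ n : ℕ, (∀ j < n, t j ≤ t (j + 1)) → (∀ j < n, ContinuousOn f (Icc (t j) (t (j + 1)))) →
      t 0 ≤ t n ∧ ContinuousOn f (Icc (t 0) (t n)) := by
  intro n
  induction n with
  | zero => intro _ _; exact ⟨le_rfl, by rw [Icc_self]; exact continuousOn_singleton f (t 0)⟩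
  | succ n ih =>
    intro hmono hcont
    obtain ⟨h0n, hc⟩ := ih (fun j hj => hmono j (Nat.lt_succ_of_lt hj)) (fun j hj => hcont j (Nat.lt_succ_of_lt hj))
    have hn : t n ≤ t (n + 1) := hmono n (Nat.lt_succ_self n)
    refine ⟨h0n.trans hn, ?_⟩
    rw [← Icc_union_Icc_eq_Icc h0n hn]
    exact hc.union_of_isClosed (hcont n (Nat.lt_succ_self n)) isClosed_Icc isClosed_Icc

namespace LevelLoop

variable {ψ : ℝ → ℝ → ℝ} {Rc Zc uin uout : ℝ} {D : ℝ → ℝ → ℝ} {N : ℕ} {t σ₁ σ₂ : ℕ → ℝ}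

/-- The partition is a monotone chain. [folklore] -/
theorem mono (Λ : LevelLoop ψ Rc Zc uin uout D N t σ₁ σ₂) : ∀ j < N, t j ≤ t (j + 1) :=
  fun j hj => (Λ.panel j hj).hab

/-- The partition has at least one panel. [folklore] -/
theorem pos (Λ : LevelLoop ψ Rc Zc uin uout D N t σ₁ σ₂) : 0 < N := by
  rcases Nat.eq_zero_or_pos N with h | h
  · exfalso
    have h1 := Λ.t_last
    rw [h, Λ.t_zero] at h1
    linarith [two_pi_pos]
  · exact h

/-- Every `θ ∈ [0, 2π]` lies in some panel. [folklore] -/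
theorem exists_panel (Λ : LevelLoop ψ Rc Zc uin uout D N t σ₁ σ₂) {θ : ℝ} (hθ : θ ∈ Icc 0 (2 * π)) :
    ∃ j < N, θ ∈ Icc (t j) (t (j + 1)) :=
  exists_Icc_of_chain N Λ.mono Λ.pos θ (by rw [Λ.t_zero]; exact hθ.1) (by rw [Λ.t_last]; exact hθ.2)

/-- **POINTWISE LOOP FACTS** at an admissible level: the level identity, `ρ_u > 0`, the certified radial slope at the surface
point and its positivity. [folklore] -/
theorem surface_facts (Λ : LevelLoop ψ Rc Zc uin uout D N t σ₁ σ₂) {u : ℝ} (hu : u ∈ Ioo uin uout) {θ : ℝ}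
    (hθ : θ ∈ Icc 0 (2 * π)) :
    rayProfile ψ Rc Zc θ (rayRadius ψ Rc Zc u θ) = u ∧ 0 < rayRadius ψ Rc Zc u θ
      ∧ HasDerivAt (rayProfile ψ Rc Zc θ) (D θ (rayRadius ψ Rc Zc u θ)) (rayRadius ψ Rc Zc u θ)
      ∧ 0 < D θ (rayRadius ψ Rc Zc u θ) := by
  obtain ⟨j, hj, hθj⟩ := Λ.exists_panel hθ
  have P := Λ.panel j hj
  have hρ := P.spec hu hθj
  exact ⟨hρ.2, P.hs₁.trans hρ.1.1, P.slope θ hθj _ (Ioo_subset_Icc_self hρ.1),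
    P.slopePos θ hθj _ (Ioo_subset_Icc_self hρ.1)⟩

/-- **`ρ_u` IS CONTINUOUS ON THE WHOLE PERIOD** for every admissible level (panel continuity glued along the chain). [folklore] -/
theorem continuousOn_rayRadius (Λ : LevelLoop ψ Rc Zc uin uout D N t σ₁ σ₂) {u : ℝ} (hu : u ∈ Ioo uin uout) :
    ContinuousOn (rayRadius ψ Rc Zc u) (Icc 0 (2 * π)) := by
  have h := (continuousOn_Icc_of_chain (f := rayRadius ψ Rc Zc u) N Λ.mono
    fun j hj => (Λ.panel j hj).continuousOn_rayRadius hu).2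
  rwa [Λ.t_zero, Λ.t_last] at h

end LevelLoop

/-! ## §3 The tree functionals `V′(u)`, `q(u)` on the glued loop, and their `u`-derivatives from the panels -/

namespace LevelLoop

variable {ψ : ℝ → ℝ → ℝ} {Rc Zc uin uout : ℝ} {D D₁ : ℝ → ℝ → ℝ} {N : ℕ} {t σ₁ σ₂ : ℕ → ℝ}
  {L : ℝ → ℝ → (ℝ × ℝ →L[ℝ] ℝ)}

/-- From the loop's panels plus the Fréchet derivative `L θ s` of `ψ` at the ray points and `R > 0` on the boxes: the
hypotheses of §1 at every admissible level, with the 2-D radial derivative IDENTIFIED with the certificate's `D` along the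
surface (`radialDeriv_eq_of_hasDerivAt`) and `D > 0` there. [folklore] -/
theorem loop_hyps (Λ : LevelLoop ψ Rc Zc uin uout D N t σ₁ σ₂)
    (hψ : ∀ j < N, ∀ θ ∈ Icc (t j) (t (j + 1)), ∀ s ∈ Icc (σ₁ j) (σ₂ j),
      HasFDerivAt (fun p : ℝ × ℝ => ψ p.1 p.2) (L θ s) (rayPoint Rc Zc θ s))
    (hR : ∀ j < N, ∀ θ ∈ Icc (t j) (t (j + 1)), ∀ s ∈ Icc (σ₁ j) (σ₂ j), 0 < Rc + s * cos θ)
    {u : ℝ} (hu : u ∈ Ioo uin uout) :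
    (∀ θ ∈ uIcc 0 (2 * π), 0 < rayRadius ψ Rc Zc u θ)
    ∧ (∀ θ ∈ uIcc 0 (2 * π), HasFDerivAt (fun p : ℝ × ℝ => ψ p.1 p.2) (L θ (rayRadius ψ Rc Zc u θ))
        (loop Rc Zc (rayRadius ψ Rc Zc u) θ))
    ∧ (∀ θ ∈ uIcc 0 (2 * π), radialDeriv (L θ (rayRadius ψ Rc Zc u θ) (1, 0)) (L θ (rayRadius ψ Rc Zc u θ) (0, 1)) θ
        = D θ (rayRadius ψ Rc Zc u θ) ∧ 0 < D θ (rayRadius ψ Rc Zc u θ))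
    ∧ (∀ θ ∈ uIcc 0 (2 * π), radialDeriv (L θ (rayRadius ψ Rc Zc u θ) (1, 0)) (L θ (rayRadius ψ Rc Zc u θ) (0, 1)) θ ≠ 0)
    ∧ (∀ θ ∈ uIcc 0 (2 * π), 0 < (loop Rc Zc (rayRadius ψ Rc Zc u) θ).1) := by
  have hI : uIcc 0 (2 * π) = Icc 0 (2 * π) := uIcc_of_le two_pi_pos.le
  have key : ∀ θ ∈ Icc 0 (2 * π), 0 < rayRadius ψ Rc Zc u θ
      ∧ HasFDerivAt (fun p : ℝ × ℝ => ψ p.1 p.2) (L θ (rayRadius ψ Rc Zc u θ)) (loop Rc Zc (rayRadius ψ Rc Zc u) θ)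
      ∧ (radialDeriv (L θ (rayRadius ψ Rc Zc u θ) (1, 0)) (L θ (rayRadius ψ Rc Zc u θ) (0, 1)) θ
          = D θ (rayRadius ψ Rc Zc u θ) ∧ 0 < D θ (rayRadius ψ Rc Zc u θ))
      ∧ 0 < (loop Rc Zc (rayRadius ψ Rc Zc u) θ).1 := by
    intro θ hθ
    obtain ⟨j, hj, hθj⟩ := Λ.exists_panel hθ
    have P := Λ.panel j hj
    have hρ := P.spec hu hθj
    have hmem : rayRadius ψ Rc Zc u θ ∈ Icc (σ₁ j) (σ₂ j) := Ioo_subset_Icc_self hρ.1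
    have hψ' := hψ j hj θ hθj _ hmem
    have hslope := P.slope θ hθj _ hmem
    refine ⟨P.hs₁.trans hρ.1.1, by rw [loop_eq_rayPoint]; exact hψ',
      ⟨radialDeriv_eq_of_hasDerivAt hψ' hslope, P.slopePos θ hθj _ hmem⟩, ?_⟩
    show 0 < Rc + rayRadius ψ Rc Zc u θ * cos θ
    exact hR j hj θ hθj _ hmem
  rw [hI]
  exact ⟨fun θ hθ => (key θ hθ).1, fun θ hθ => (key θ hθ).2.1, fun θ hθ => (key θ hθ).2.2.1,
    fun θ hθ => by rw [(key θ hθ).2.2.1.1]; exact (key θ hθ).2.2.1.2.ne', fun θ hθ => (key θ hθ).2.2.2⟩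

/-- **`V′(u)` OF THE TREE FUNCTIONAL = `2π ∫₀^{2π} volKernel`** on the glued loop, for EVERY admissible level `u`.
[cite: Jardin2010, §5.3 eq. (5.29)] -/
theorem volumeDerivE_eq (Λ : LevelLoop ψ Rc Zc uin uout D N t σ₁ σ₂)
    (hψ : ∀ j < N, ∀ θ ∈ Icc (t j) (t (j + 1)), ∀ s ∈ Icc (σ₁ j) (σ₂ j),
      HasFDerivAt (fun p : ℝ × ℝ => ψ p.1 p.2) (L θ s) (rayPoint Rc Zc θ s))
    (hR : ∀ j < N, ∀ θ ∈ Icc (t j) (t (j + 1)), ∀ s ∈ Icc (σ₁ j) (σ₂ j), 0 < Rc + s * cos θ)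
    {u : ℝ} (hu : u ∈ Ioo uin uout) :
    volumeDerivE ψ (loop Rc Zc (rayRadius ψ Rc Zc u)) (2 * π)
      = 2 * π * ∫ θ in (0 : ℝ)..(2 * π), volKernel Rc D θ (rayRadius ψ Rc Zc u θ) := by
  obtain ⟨hρ0, hψ', hDeq, hDr, hR'⟩ := Λ.loop_hyps hψ hR hu
  have hlev : ∀ θ ∈ Icc 0 (2 * π), rayProfile ψ Rc Zc θ (rayRadius ψ Rc Zc u θ) = u :=
    fun θ hθ => (Λ.surface_facts hu hθ).1
  rw [volumeDerivE_eq_polar_rayRadius hlev (Λ.continuousOn_rayRadius hu) hρ0 hψ' hDr hR']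
  congr 1
  apply intervalIntegral.integral_congr
  intro θ hθ
  simp only
  rw [(hDeq θ hθ).1, abs_of_pos (hDeq θ hθ).2]
  rfl

/-- **`q(u)` OF THE TREE FUNCTIONAL = `(F/2π) ∫₀^{2π} polarIntegrand`** on the glued loop, for EVERY admissible level `u`
(the Loop file's `safetyFactorE_eq_polar_rayRadius` with `|D_r| = D`). [cite: Freidberg2014, §6.3.5 eq. (6.35)] -/
theorem safetyFactorE_eq (Λ : LevelLoop ψ Rc Zc uin uout D N t σ₁ σ₂) (F : ℝ)
    (hψ : ∀ j < N, ∀ θ ∈ Icc (t j) (t (j + 1)), ∀ s ∈ Icc (σ₁ j) (σ₂ j),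
      HasFDerivAt (fun p : ℝ × ℝ => ψ p.1 p.2) (L θ s) (rayPoint Rc Zc θ s))
    (hR : ∀ j < N, ∀ θ ∈ Icc (t j) (t (j + 1)), ∀ s ∈ Icc (σ₁ j) (σ₂ j), 0 < Rc + s * cos θ)
    {u : ℝ} (hu : u ∈ Ioo uin uout) :
    safetyFactorE F ψ (loop Rc Zc (rayRadius ψ Rc Zc u)) (2 * π)
      = F / (2 * π) * ∫ θ in (0 : ℝ)..(2 * π), polarIntegrand ψ Rc Zc u D θ := by
  obtain ⟨hρ0, hψ', hDeq, hDr, hR'⟩ := Λ.loop_hyps hψ hR hu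
  have hlev : ∀ θ ∈ Icc 0 (2 * π), rayProfile ψ Rc Zc θ (rayRadius ψ Rc Zc u θ) = u :=
    fun θ hθ => (Λ.surface_facts hu hθ).1
  rw [safetyFactorE_eq_polar_rayRadius hlev (Λ.continuousOn_rayRadius hu) hρ0 hψ' hDr hR']
  congr 1
  apply intervalIntegral.integral_congr
  intro θ hθ
  simp only
  rw [(hDeq θ hθ).1, abs_of_pos (hDeq θ hθ).2]
  rfl

/-- **`dV′/du` FROM THE PANELS.**  With a jointly continuous second ray derivative `D₁ = ∂_s D` on every box:
`HasDerivAt (u ↦ volumeDerivE ψ (loop R_c Z_c ρ_u) (2π)) (2π ∫₀^{2π} volKernelDs(θ, ρ_{u₀} θ)/D(θ, ρ_{u₀} θ) dθ) u₀` — Jardin's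
`V″ = d²V/dψ²` of (8.134) in the label `ψ = u`, on an IMPLICIT surface, as one θ-integral of an explicit kernel.
[cite: Jardin2010, §5.3 eq. (5.29); §8.5 eq. (8.134)] -/
theorem hasDerivAt_volumeDerivE (Λ : LevelLoop ψ Rc Zc uin uout D N t σ₁ σ₂)
    (hψ : ∀ j < N, ∀ θ ∈ Icc (t j) (t (j + 1)), ∀ s ∈ Icc (σ₁ j) (σ₂ j),
      HasFDerivAt (fun p : ℝ × ℝ => ψ p.1 p.2) (L θ s) (rayPoint Rc Zc θ s))
    (hR : ∀ j < N, ∀ θ ∈ Icc (t j) (t (j + 1)), ∀ s ∈ Icc (σ₁ j) (σ₂ j), 0 < Rc + s * cos θ)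
    (hD₁ : ∀ j < N, ∀ θ ∈ Icc (t j) (t (j + 1)), ∀ s ∈ Icc (σ₁ j) (σ₂ j), HasDerivAt (D θ) (D₁ θ s) s)
    (hD₁c : ∀ j < N, ContinuousOn (fun p : ℝ × ℝ => D₁ p.1 p.2) (Icc (t j) (t (j + 1)) ×ˢ Icc (σ₁ j) (σ₂ j)))
    {u₀ : ℝ} (hu₀ : u₀ ∈ Ioo uin uout) :
    HasDerivAt (fun u => volumeDerivE ψ (loop Rc Zc (rayRadius ψ Rc Zc u)) (2 * π))
      (2 * π * ∫ θ in (0 : ℝ)..(2 * π),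
        volKernelDs Rc D D₁ θ (rayRadius ψ Rc Zc u₀ θ) / D θ (rayRadius ψ Rc Zc u₀ θ)) u₀ := by
  have hD0 : ∀ j < N, ∀ p ∈ Icc (t j) (t (j + 1)) ×ˢ Icc (σ₁ j) (σ₂ j), D p.1 p.2 ≠ 0 :=
    fun j hj p hp => ((Λ.panel j hj).slopePos p.1 hp.1 p.2 hp.2).ne'
  have h := hasDerivAt_integral_of_adjacent (N := N) (t := t)
    (F := fun u θ => volKernel Rc D θ (rayRadius ψ Rc Zc u θ))
    (G := fun θ => volKernelDs Rc D D₁ θ (rayRadius ψ Rc Zc u₀ θ) / D θ (rayRadius ψ Rc Zc u₀ θ)) (u₀ := u₀)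
    (fun j hj => (Λ.panel j hj).eventually_intervalIntegrable_kernel
      (continuousOn_volKernel (Λ.panel j hj).slopeCont (hD0 j hj)) hu₀)
    (fun j hj => ((Λ.panel j hj).hasDerivAt_volIntegral hu₀ (hD₁ j hj) (hD₁c j hj)).1)
    (fun j hj => ((Λ.panel j hj).hasDerivAt_volIntegral hu₀ (hD₁ j hj) (hD₁c j hj)).2)
  rw [Λ.t_zero, Λ.t_last] at h
  have hev : (fun u => volumeDerivE ψ (loop Rc Zc (rayRadius ψ Rc Zc u)) (2 * π))
      =ᶠ[𝓝 u₀] fun u => 2 * π * ∫ θ in (0 : ℝ)..(2 * π), volKernel Rc D θ (rayRadius ψ Rc Zc u θ) := by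
    filter_upwards [Ioo_mem_nhds hu₀.1 hu₀.2] with u hu
    exact Λ.volumeDerivE_eq hψ hR hu
  exact (h.const_mul (2 * π)).congr_of_eventuallyEq hev

/-- **`dq/du` FROM THE PANELS.**  With a jointly continuous second ray derivative `D₁ = ∂_s D` on every box:
`HasDerivAt (u ↦ safetyFactorE F ψ (loop R_c Z_c ρ_u) (2π)) ((F/2π) ∫₀^{2π} polarKernelDs(θ, ρ_{u₀} θ)/D(θ, ρ_{u₀} θ) dθ) u₀` —
the shear input of (8.134) (`Φ″ = 2π dq/dΨ`, `Λ = −Ψ′²q′`) on an IMPLICIT surface, as one θ-integral of an explicit kernel.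
[cite: Freidberg2014, §6.3.5 eq. (6.35); Jardin2010, §8.5 eq. (8.134)] -/
theorem hasDerivAt_safetyFactorE (Λ : LevelLoop ψ Rc Zc uin uout D N t σ₁ σ₂) (F : ℝ)
    (hψ : ∀ j < N, ∀ θ ∈ Icc (t j) (t (j + 1)), ∀ s ∈ Icc (σ₁ j) (σ₂ j),
      HasFDerivAt (fun p : ℝ × ℝ => ψ p.1 p.2) (L θ s) (rayPoint Rc Zc θ s))
    (hR : ∀ j < N, ∀ θ ∈ Icc (t j) (t (j + 1)), ∀ s ∈ Icc (σ₁ j) (σ₂ j), 0 < Rc + s * cos θ)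
    (hD₁ : ∀ j < N, ∀ θ ∈ Icc (t j) (t (j + 1)), ∀ s ∈ Icc (σ₁ j) (σ₂ j), HasDerivAt (D θ) (D₁ θ s) s)
    (hD₁c : ∀ j < N, ContinuousOn (fun p : ℝ × ℝ => D₁ p.1 p.2) (Icc (t j) (t (j + 1)) ×ˢ Icc (σ₁ j) (σ₂ j)))
    {u₀ : ℝ} (hu₀ : u₀ ∈ Ioo uin uout) :
    HasDerivAt (fun u => safetyFactorE F ψ (loop Rc Zc (rayRadius ψ Rc Zc u)) (2 * π))
      (F / (2 * π) * ∫ θ in (0 : ℝ)..(2 * π),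
        polarKernelDs Rc D D₁ θ (rayRadius ψ Rc Zc u₀ θ) / D θ (rayRadius ψ Rc Zc u₀ θ)) u₀ := by
  have hD0 : ∀ j < N, ∀ p ∈ Icc (t j) (t (j + 1)) ×ˢ Icc (σ₁ j) (σ₂ j), D p.1 p.2 ≠ 0 :=
    fun j hj p hp => ((Λ.panel j hj).slopePos p.1 hp.1 p.2 hp.2).ne'
  have hR0 : ∀ j < N, ∀ p ∈ Icc (t j) (t (j + 1)) ×ˢ Icc (σ₁ j) (σ₂ j), Rc + p.2 * cos p.1 ≠ 0 :=
    fun j hj p hp => (hR j hj p.1 hp.1 p.2 hp.2).ne'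
  have h := hasDerivAt_integral_of_adjacent (N := N) (t := t)
    (F := fun u θ => polarIntegrand ψ Rc Zc u D θ)
    (G := fun θ => polarKernelDs Rc D D₁ θ (rayRadius ψ Rc Zc u₀ θ) / D θ (rayRadius ψ Rc Zc u₀ θ)) (u₀ := u₀)
    (fun j hj => by
      simp only [polarIntegrand_eq_polarKernel]
      exact (Λ.panel j hj).eventually_intervalIntegrable_kernel
        (continuousOn_polarKernel (Λ.panel j hj).slopeCont (hD0 j hj) (hR0 j hj)) hu₀)
    (fun j hj => ((Λ.panel j hj).hasDerivAt_polarIntegral hu₀ (hR j hj) (hD₁ j hj) (hD₁c j hj)).1)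
    (fun j hj => ((Λ.panel j hj).hasDerivAt_polarIntegral hu₀ (hR j hj) (hD₁ j hj) (hD₁c j hj)).2)
  rw [Λ.t_zero, Λ.t_last] at h
  have hev : (fun u => safetyFactorE F ψ (loop Rc Zc (rayRadius ψ Rc Zc u)) (2 * π))
      =ᶠ[𝓝 u₀] fun u => F / (2 * π) * ∫ θ in (0 : ℝ)..(2 * π), polarIntegrand ψ Rc Zc u D θ := by
    filter_upwards [Ioo_mem_nhds hu₀.1 hu₀.2] with u hu
    exact Λ.safetyFactorE_eq F hψ hR hu
  exact (h.const_mul (F / (2 * π))).congr_of_eventuallyEq hev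

end LevelLoop

end PolarRay

end Summit.Ventures.FusionMHD.Models

end
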